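import Summits.CriticalPhenomena.PercolationContinuityZ3.Theorems.FK.MagnetizationLDPNonzeroField
import Summits.CriticalPhenomena.PercolationContinuityZ3.Theorems.FK.MagnetizationLDPGibbsStates
import HarnessLib

/-!
# THE LEVEL-1 LDP OF THE MAGNETISATION, UNIFORMLY IN THE BOUNDARY CONDITION AND UNDER EVERY INFINITE-VOLUME GIBBS STATE, AT
# EVERY `(β, h)` (Ellis 2006 Thm. II.6.1 / Thm. V.6.1; Olla 1988 Thm. 5.2 «uniformly in ω′»; Föllmer–Orey 1988)

Claimed R42 (8)(c) in the cell INBOX at 2026-08-29T11:54:27Z by fkp-10a gen 360 (NEW CLAIM #1 of the gen), addressed to the lane under (ι) (coordinator fk-4 gen 295 CLOSED l.8907 11:26:11Z 2026-08-29; «(ι) RESUMES») and to the next seated fk-4 generation (ruling R182 requested); lineage row FO-10a-g360 (self-suggested), package g360-plateau, label PL-F.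
Helper file of the `fk-continuity` build cell (bschramm lane; `--supports stmt-CriticalPhenomena-4575`; fkp-10a gen 360,
package g360-plateau, label PL-F); builds on p205010 (kernel theorem, internal audit signed; external expert review
pending). No definitions, no named facts, no sorries; standard axioms.
UNCONDITIONAL (nearest-neighbour Ising model on `ℤ^d`, `d ≥ 1`, `β > 0`, every real `h`; boxes `Λ_N = {−N,…,N}^d`; EVERY boundary
condition with ONE `N₀`; every DLR Gibbs state `μ ∈ isingGibbsMeasures d β h`; `M_N = Σ_{x∈Λ_N} σ_x`, `ψ = pressure d β`).
Scope: the lower large-deviation bounds of `MagnetizationLargeDeviationsLower` (exposed densities) and `MagnetizationLDPNonzeroField`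
(the plateau at field `h`) made UNIFORM in the boundary condition («∀ᶠ N, ∀ bc» instead of «∀ bc, ∀ᶠ N»), and hence transferred to
every infinite-volume Gibbs state by the DLR equation; no rate-function object, no level-2/3 statement; nothing percolation-bearing.

* `eventually_forall_bc_exp_le_window_of_forall_exp_le` — the tilting step, uniformly: a sub-exponentially massive window at the
  tilted field `h + s` for ALL `bc` at once gives the lower bound at `h` for all `bc` at once (uniform convergence of the
  finite-volume pressures, `eventually_forall_bc_abs_pressureIn_sub_pressure_lt`);
* `eventually_forall_bc_ld_lower_of_hasDerivAt` — LD-D's lower bound at an exposed density, uniformly in `bc`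
  (LD-I's `exp_concentration_uniform_of_hasDerivAt`);
* `eventually_forall_bc_ld_lower_plateau_field` — PL-D's plateau bound at field `h`, uniformly in `bc`;
* **`exists_rate_attained_and_forall_bc_ld_bounds`** — at every `(β>0, h)`, every `|a| < 1`: a field increment `s` attaining the
  Legendre supremum, the lower bound `exp(−|Λ_N|(I + |βs|δ + ε)) ≤ μ^{bc}_{Λ_N;β,h}{|M_N/|Λ_N| − a| < δ}` and the far-half-line
  upper bound `≤ exp(−|Λ_N|(I − ε))`, for all `N ≥ N₀` and ALL `bc` with one `N₀`;
* **`gibbs_exists_rate_attained_and_ld_bounds`** — the same two-sided statement under EVERY infinite-volume Gibbs state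
  `μ ∈ 𝒢(β,h)`; `gibbs_ld_lower_plateau_field`, `gibbs_ld_lower_of_hasDerivAt` are the named special cases.

## References

* R. S. Ellis, *Entropy, Large Deviations, and Statistical Mechanics*, Springer (2006), Thm. II.6.1, §IV.5 (4.33)–(4.34),
  Thm. V.6.1. [Ellis2006]
* S. Olla, *Large deviations for Gibbs random fields*, PTRF 77 (1988), Thm. 5.2. [Olla1988]
* H. Föllmer, S. Orey, Ann. Probab. 16 (1988) 961–977, Thm. 3.1. [FollmerOrey1988]
* O. E. Lanford, LNP 20 (1973), §A4–§B. [Lanford1973]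
* S. Friedli, Y. Velenik, *Statistical Mechanics of Lattice Systems*, CUP (2017), Def. 6.13, Thm. 3.6. [FriedliVelenik2017]
-/

noncomputable section

namespace Summit.CriticalPhenomena.PercolationContinuityZ3.Theorems.FK

namespace IsingLargeDeviations

open MeasureTheory Filter Topology Finset Set
open Literature.Probability.LatticeModels

variable {d : ℕ}

/-! ### The tilting step, uniformly in the boundary condition -/

/-- **UNIFORM TILTING STEP**: if eventually in `N`, for ALL `bc`, `e^{−ε₁|Λ_N|} ≤ μ^{bc}_{Λ_N;β,h+s}{|M_N/|Λ_N| − a| < δ}`, then for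
every `ε > 0`, eventually in `N`, for all `bc`,
`exp(−|Λ_N|(βsa − (ψ(h+s) − ψ(h)) + |βs|δ + ε₁ + ε)) ≤ μ^{bc}_{Λ_N;β,h}{|M_N/|Λ_N| − a| < δ}`.
[cite: Ellis2006, Thm. II.6.1 (c) (proof) with §IV.5 (4.33); Olla1988, Thm. 5.2] -/
theorem eventually_forall_bc_exp_le_window_of_forall_exp_le (β h s a δ : ℝ) {ε₁ : ℝ}
    (hW : ∀ᶠ N : ℕ in atTop, ∀ bc : BoundaryCondition (Site d), Real.exp (-(ε₁ * #(box d N))) ≤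
      (isingMeasure (zdGraph d) (box d N) β (h + s) bc).real {σ | |(∑ x ∈ box d N, spinAt x σ) / #(box d N) - a| < δ})
    {ε : ℝ} (hε : 0 < ε) :
    ∀ᶠ N : ℕ in atTop, ∀ bc : BoundaryCondition (Site d),
      Real.exp (-(#(box d N) * (β * s * a - (pressure d β (h + s) - pressure d β h) + |β * s| * δ + ε₁ + ε))) ≤
        (isingMeasure (zdGraph d) (box d N) β h bc).real {σ | |(∑ x ∈ box d N, spinAt x σ) / #(box d N) - a| < δ} := by
  filter_upwards [hW, eventually_forall_bc_abs_pressureIn_sub_pressure_lt (d := d) β (h + s) (half_pos hε),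
    eventually_forall_bc_abs_pressureIn_sub_pressure_lt (d := d) β h (half_pos hε)] with N hN h1 h2 bc
  have hΛ := box_nonempty d N
  have hV : (0 : ℝ) < #(box d N) := by exact_mod_cast hΛ.card_pos
  have htilt := exp_mul_measureReal_window_le (zdGraph d) (box d N) β h s bc (a * #(box d N)) (δ * #(box d N))
  rw [← setOf_abs_div_sub_lt_eq hΛ, isingPartitionFunction_div_eq_exp_card_mul (zdGraph d) hΛ] at htilt
  refine le_trans ?_ htilt
  have ha' := (abs_lt.1 (h1 bc)).1
  have hb' := (abs_lt.1 (h2 bc)).2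
  have h3 : pressure d β (h + s) - pressure d β h - ε ≤
      pressureIn (zdGraph d) (box d N) β (h + s) bc - pressureIn (zdGraph d) (box d N) β h bc := by linarith
  have hpos1 : 0 < Real.exp (-(β * s * (a * #(box d N))) - |β * s| * (δ * #(box d N))) *
      Real.exp (#(box d N) * (pressureIn (zdGraph d) (box d N) β (h + s) bc - pressureIn (zdGraph d) (box d N) β h bc)) :=
    by positivity
  calc Real.exp (-(#(box d N) * (β * s * a - (pressure d β (h + s) - pressure d β h) + |β * s| * δ + ε₁ + ε)))
      = Real.exp (-(β * s * (a * #(box d N))) - |β * s| * (δ * #(box d N))) *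
          Real.exp (#(box d N) * (pressure d β (h + s) - pressure d β h - ε)) *
          Real.exp (-(ε₁ * #(box d N))) := by
        rw [← Real.exp_add, ← Real.exp_add]; congr 1; ring
    _ ≤ Real.exp (-(β * s * (a * #(box d N))) - |β * s| * (δ * #(box d N))) *
          Real.exp (#(box d N) * (pressureIn (zdGraph d) (box d N) β (h + s) bc -
            pressureIn (zdGraph d) (box d N) β h bc)) *
          (isingMeasure (zdGraph d) (box d N) β (h + s) bc).real
            {σ | |(∑ x ∈ box d N, spinAt x σ) / #(box d N) - a| < δ} :=
        mul_le_mul (mul_le_mul_of_nonneg_left (Real.exp_le_exp.2 (mul_le_mul_of_nonneg_left h3 hV.le))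
          (Real.exp_pos _).le) (hN bc) (Real.exp_pos _).le (by positivity)

/-! ### The lower bounds, uniformly in the boundary condition -/

/-- **LD LOWER BOUND AT AN EXPOSED DENSITY, UNIFORMLY IN THE BOUNDARY CONDITION** (`d ≥ 1`, `β > 0`): if `ψ'(β,·)(h+s) = D` then for
`δ, ε > 0`, eventually in `N`, for ALL `bc`, `exp(−|Λ_N|(sD − (ψ(h+s) − ψ(h)) + |βs|δ + ε)) ≤ μ^{bc}_{Λ_N;β,h}{|M_N/|Λ_N| − D/β| < δ}`.
[cite: Ellis2006, Thm. II.6.1 (c) and Thm. II.6.3; Olla1988, Thm. 5.2] -/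
theorem eventually_forall_bc_ld_lower_of_hasDerivAt (hd : 1 ≤ d) {β : ℝ} (hβ : 0 < β) {h s D : ℝ}
    (hD : HasDerivAt (fun t => pressure d β t) D (h + s)) {δ : ℝ} (hδ : 0 < δ) {ε : ℝ} (hε : 0 < ε) :
    ∀ᶠ N : ℕ in atTop, ∀ bc : BoundaryCondition (Site d),
      Real.exp (-(#(box d N) * (s * D - (pressure d β (h + s) - pressure d β h) + |β * s| * δ + ε))) ≤
        (isingMeasure (zdGraph d) (box d N) β h bc).real
          {σ | |(∑ x ∈ box d N, spinAt x σ) / #(box d N) - D / β| < δ} := by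
  obtain ⟨c, hc, hconc⟩ := exp_concentration_uniform_of_hasDerivAt hd hβ hD hδ
  -- the window at the exposed point has mass `≥ 1/2 ≥ e^{−(ε/2)|Λ_N|}` under the tilted states, for all `bc`
  have hcard : Tendsto (fun N : ℕ => (#(box d N) : ℝ)) atTop atTop := by
    refine tendsto_atTop_mono (fun N => ?_) tendsto_natCast_atTop_atTop
    have h1 : N ≤ #(box d N) := by
      rw [card_box]
      exact (show N ≤ 2 * N + 1 by omega).trans (Nat.le_self_pow (by omega) _)
    exact_mod_cast h1
  have hsmall : ∀ {c' : ℝ}, 0 < c' → ∀ᶠ N : ℕ in atTop, Real.exp (-(c' * (#(box d N) : ℝ))) ≤ 1 / 2 := by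
    intro c' hc'
    have h1 : Tendsto (fun N : ℕ => Real.exp (-(c' * (#(box d N) : ℝ)))) atTop (𝓝 0) :=
      Real.tendsto_exp_atBot.comp (tendsto_neg_atTop_atBot.comp (hcard.const_mul_atTop hc'))
    exact h1.eventually (eventually_le_nhds (by norm_num))
  have hW : ∀ᶠ N : ℕ in atTop, ∀ bc : BoundaryCondition (Site d), Real.exp (-(ε / 2 * #(box d N))) ≤
      (isingMeasure (zdGraph d) (box d N) β (h + s) bc).real
        {σ | |(∑ x ∈ box d N, spinAt x σ) / #(box d N) - D / β| < δ} := by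
    filter_upwards [hconc, hsmall hc, hsmall (half_pos hε)] with N hN h2 h3 bc
    set μ := isingMeasure (zdGraph d) (box d N) β (h + s) bc
    have hcompl : {σ : SpinConfig (Site d) | |(∑ x ∈ box d N, spinAt x σ) / #(box d N) - D / β| < δ} =
        {σ | δ ≤ |(∑ x ∈ box d N, spinAt x σ) / #(box d N) - D / β|}ᶜ := by
      ext σ; simp only [mem_setOf_eq, mem_compl_iff, not_le]
    have hmeas : MeasurableSet {σ : SpinConfig (Site d) | δ ≤ |(∑ x ∈ box d N, spinAt x σ) / #(box d N) - D / β|} :=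
      measurableSet_le measurable_const (((measurable_sum_spinAt (box d N)).div_const _).sub_const _).abs
    rw [hcompl, measureReal_compl hmeas, probReal_univ]
    linarith [hN bc]
  have h1 := eventually_forall_bc_exp_le_window_of_forall_exp_le (d := d) β h s (D / β) δ hW (half_pos hε)
  have hsD : β * s * (D / β) = s * D := by field_simp
  refine h1.mono fun N hN bc => le_of_eq_of_le ?_ (hN bc)
  rw [hsD]
  congr 2
  ring

/-- **THE PLATEAU AT FIELD `h`, UNIFORMLY IN THE BOUNDARY CONDITION** (`d ≥ 1`, `β > 0`, `|a| ≤ m*(β)`): for `δ, ε > 0`, eventually in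
`N`, for ALL `bc`, `exp(−|Λ_N|(ψ(h) − ψ(0) − βha + |βh|δ + ε)) ≤ μ^{bc}_{Λ_N;β,h}{|M_N/|Λ_N| − a| < δ}`.
[cite: Ellis2006, Thm. II.6.1 (c), Thm. V.6.1; Olla1988, Thm. 5.2; Lanford1973, §B] -/
theorem eventually_forall_bc_ld_lower_plateau_field (hd : 1 ≤ d) {β : ℝ} (hβ : 0 < β) (h : ℝ) {a : ℝ}
    (ha : |a| ≤ spontaneousMagnetization d β) {δ : ℝ} (hδ : 0 < δ) {ε : ℝ} (hε : 0 < ε) :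
    ∀ᶠ N : ℕ in atTop, ∀ bc : BoundaryCondition (Site d),
      Real.exp (-(#(box d N) * (pressure d β h - pressure d β 0 - β * h * a + |β * h| * δ + ε))) ≤
        (isingMeasure (zdGraph d) (box d N) β h bc).real {σ | |(∑ x ∈ box d N, spinAt x σ) / #(box d N) - a| < δ} := by
  have hW : ∀ᶠ N : ℕ in atTop, ∀ bc : BoundaryCondition (Site d), Real.exp (-(ε / 2 * #(box d N))) ≤
      (isingMeasure (zdGraph d) (box d N) β (h + -h) bc).real
        {σ | |(∑ x ∈ box d N, spinAt x σ) / #(box d N) - a| < δ} := by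
    rw [add_neg_cancel]
    exact eventually_forall_bc_exp_le_plateau_window hd hβ ha hδ (half_pos hε)
  have h1 := eventually_forall_bc_exp_le_window_of_forall_exp_le (d := d) β h (-h) a δ hW (half_pos hε)
  refine h1.mono fun N hN bc => le_of_eq_of_le ?_ (hN bc)
  rw [add_neg_cancel, mul_neg, abs_neg]
  congr 1
  ring

/-! ### The LDP at every density with one `N₀` for all boundary conditions -/

/-- **THE LEVEL-1 LDP AT EVERY DENSITY, UNIFORMLY IN THE BOUNDARY CONDITION** (`d ≥ 1`, `β > 0`): for every `h`, every `|a| < 1`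
and `δ, ε > 0` there is a field increment `s` with (i) `βua − (ψ(h+u) − ψ(h)) ≤ I := βsa − (ψ(h+s) − ψ(h))` for all `u`;
(ii) eventually in `N`, for ALL `bc`, `exp(−|Λ_N|(I + |βs|δ + ε)) ≤ μ^{bc}_{Λ_N;β,h}{|M_N/|Λ_N| − a| < δ}`; (iii) eventually in `N`,
for all `bc`, the far half-line bound `≤ exp(−|Λ_N|(I − ε))` (`{a|Λ_N| ≤ M_N}` if `s ≥ 0`, `{M_N ≤ a|Λ_N|}` if `s ≤ 0`).
[cite: Ellis2006, Thm. II.6.1, (2.28), §IV.5 (4.34), Thm. V.6.1; Olla1988, Thm. 5.2; FollmerOrey1988, Thm. 3.1] -/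
theorem exists_rate_attained_and_forall_bc_ld_bounds (hd : 1 ≤ d) {β : ℝ} (hβ : 0 < β) (h : ℝ) {a : ℝ} (ha : |a| < 1)
    {δ : ℝ} (hδ : 0 < δ) {ε : ℝ} (hε : 0 < ε) :
    ∃ s : ℝ,
      (∀ u : ℝ, β * u * a - (pressure d β (h + u) - pressure d β h) ≤
        β * s * a - (pressure d β (h + s) - pressure d β h)) ∧
      (∀ᶠ N : ℕ in atTop, ∀ bc : BoundaryCondition (Site d),
        Real.exp (-(#(box d N) * (β * s * a - (pressure d β (h + s) - pressure d β h) + |β * s| * δ + ε))) ≤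
          (isingMeasure (zdGraph d) (box d N) β h bc).real
            {σ | |(∑ x ∈ box d N, spinAt x σ) / #(box d N) - a| < δ}) ∧
      (0 ≤ s → ∀ᶠ N : ℕ in atTop, ∀ bc : BoundaryCondition (Site d),
        (isingMeasure (zdGraph d) (box d N) β h bc).real {σ | a * #(box d N) ≤ ∑ x ∈ box d N, spinAt x σ} ≤
          Real.exp (-(#(box d N) * (β * s * a - (pressure d β (h + s) - pressure d β h) - ε)))) ∧
      (s ≤ 0 → ∀ᶠ N : ℕ in atTop, ∀ bc : BoundaryCondition (Site d),
        (isingMeasure (zdGraph d) (box d N) β h bc).real {σ | ∑ x ∈ box d N, spinAt x σ ≤ a * #(box d N)} ≤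
          Real.exp (-(#(box d N) * (β * s * a - (pressure d β (h + s) - pressure d β h) - ε)))) := by
  have hup : ∀ s : ℝ, 0 ≤ s → ∀ᶠ N : ℕ in atTop, ∀ bc : BoundaryCondition (Site d),
      (isingMeasure (zdGraph d) (box d N) β h bc).real {σ | a * #(box d N) ≤ ∑ x ∈ box d N, spinAt x σ} ≤
        Real.exp (-(#(box d N) * (β * s * a - (pressure d β (h + s) - pressure d β h) - ε))) := fun s hs =>
    eventually_forall_bc_measureReal_le_sum_spinAt_le (d := d) (mul_nonneg hβ.le hs) h a hε
  have hlow : ∀ s : ℝ, s ≤ 0 → ∀ᶠ N : ℕ in atTop, ∀ bc : BoundaryCondition (Site d),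
      (isingMeasure (zdGraph d) (box d N) β h bc).real {σ | ∑ x ∈ box d N, spinAt x σ ≤ a * #(box d N)} ≤
        Real.exp (-(#(box d N) * (β * s * a - (pressure d β (h + s) - pressure d β h) - ε))) := by
    intro s hs
    have h1 := eventually_forall_bc_measureReal_sum_spinAt_le_le (d := d) (β := β) (s := -s) (by nlinarith) h a hε
    refine h1.mono fun N hN bc => (hN bc).trans_eq ?_
    rw [sub_neg_eq_add]
    congr 1
    ring
  by_cases hpl : |a| ≤ spontaneousMagnetization d β
  · refine ⟨-h, fun u => ?_, ?_, hup (-h), hlow (-h)⟩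
    · rw [rate_field_affine_eq]
      exact rate_field_le_affine_of_abs_le_spontaneousMagnetization hd hβ.le h hpl u
    · have h1 := eventually_forall_bc_ld_lower_plateau_field hd hβ h hpl hδ hε
      refine h1.mono fun N hN bc => le_of_eq_of_le ?_ (hN bc)
      rw [rate_field_affine_eq, mul_neg, abs_neg]
  · rw [not_le] at hpl
    have hD : ∃ k : ℝ, HasDerivAt (fun t => pressure d β t) (β * a) k := by
      rcases le_or_gt 0 a with ha0 | ha0
      · rw [abs_of_nonneg ha0] at ha hpl
        obtain ⟨k, hk, hka⟩ := exists_pos_field_magnetizationInField_eq (d := d) hβ hpl ha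
        exact ⟨k, hka ▸ IsingSusceptibility.hasDerivAt_pressure_field hd hβ.le hk⟩
      · rw [abs_of_neg ha0] at ha hpl
        obtain ⟨k, hk, hka⟩ := exists_pos_field_magnetizationInField_eq (d := d) hβ hpl ha
        refine ⟨-k, ?_⟩
        have := IsingSusceptibility.hasDerivAt_pressure_field_of_neg hd hβ.le (neg_neg_of_pos hk)
        rw [neg_neg, hka, mul_neg, neg_neg] at this
        exact this
    obtain ⟨k, hk⟩ := hD
    refine ⟨k - h, fun u => ?_, ?_, hup (k - h), hlow (k - h)⟩
    · have hk' : HasDerivAt (fun t => pressure d β t) (β * a) (h + (k - h)) := by rwa [add_sub_cancel]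
      exact rate_le_rate_of_hasDerivAt (d := d) hk' u
    · have hk' : HasDerivAt (fun t => pressure d β t) (β * a) (h + (k - h)) := by rwa [add_sub_cancel]
      have h1 := eventually_forall_bc_ld_lower_of_hasDerivAt hd hβ hk' hδ hε
      refine h1.mono fun N hN bc => le_of_eq_of_le ?_ ((hN bc).trans_eq ?_)
      · congr 2; ring
      · rw [mul_div_cancel_left₀ _ hβ.ne']

/-! ### Every infinite-volume Gibbs state -/

/-- **THE LEVEL-1 LDP UNDER EVERY INFINITE-VOLUME GIBBS STATE** (`d ≥ 1`, `β > 0`, every `h`, every `μ ∈ 𝒢(β,h)`, every `|a| < 1`,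
`δ, ε > 0`): there is `s` with (i) the Legendre supremum `I = βsa − (ψ(h+s) − ψ(h))` attained at `s`; (ii) eventually
`exp(−|Λ_N|(I + |βs|δ + ε)) ≤ μ{|M_N/|Λ_N| − a| < δ}`; (iii) eventually the far half-line bound `μ{…} ≤ exp(−|Λ_N|(I − ε))`.
At `h = 0` the rate vanishes exactly on `[−m*, m*]` (Ellis V.6.1 (d)–(e): the mixtures `λμ⁺ + (1−λ)μ⁻` charge the whole plateau at
sub-volume-order cost). [cite: Ellis2006, Thm. V.6.1 and Note 13 to Ch. IV; FollmerOrey1988, Thm. 3.1; Olla1988, Thm. 5.2] -/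
theorem gibbs_exists_rate_attained_and_ld_bounds (hd : 1 ≤ d) {β : ℝ} (hβ : 0 < β) {h : ℝ}
    {μ : Measure (SpinConfig (Site d))} (hμ : μ ∈ isingGibbsMeasures d β h) {a : ℝ} (ha : |a| < 1)
    {δ : ℝ} (hδ : 0 < δ) {ε : ℝ} (hε : 0 < ε) :
    ∃ s : ℝ,
      (∀ u : ℝ, β * u * a - (pressure d β (h + u) - pressure d β h) ≤
        β * s * a - (pressure d β (h + s) - pressure d β h)) ∧
      (∀ᶠ N : ℕ in atTop,
        Real.exp (-(#(box d N) * (β * s * a - (pressure d β (h + s) - pressure d β h) + |β * s| * δ + ε))) ≤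
          μ.real {σ | |(∑ x ∈ box d N, spinAt x σ) / #(box d N) - a| < δ}) ∧
      (0 ≤ s → ∀ᶠ N : ℕ in atTop, μ.real {σ | a * #(box d N) ≤ ∑ x ∈ box d N, spinAt x σ} ≤
          Real.exp (-(#(box d N) * (β * s * a - (pressure d β (h + s) - pressure d β h) - ε)))) ∧
      (s ≤ 0 → ∀ᶠ N : ℕ in atTop, μ.real {σ | ∑ x ∈ box d N, spinAt x σ ≤ a * #(box d N)} ≤
          Real.exp (-(#(box d N) * (β * s * a - (pressure d β (h + s) - pressure d β h) - ε)))) := by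
  obtain ⟨s, h1, h2, h3, h4⟩ := exists_rate_attained_and_forall_bc_ld_bounds hd hβ h ha hδ hε
  have hWm : ∀ N : ℕ, MeasurableSet {σ : SpinConfig (Site d) | |(∑ x ∈ box d N, spinAt x σ) / #(box d N) - a| < δ} :=
    fun N => measurableSet_lt (((measurable_sum_spinAt _).div_const _).sub_const _).abs measurable_const
  refine ⟨s, h1, ?_, fun hs => ?_, fun hs => ?_⟩
  · filter_upwards [h2] with N hN
    exact le_measureReal_of_forall_fixed hμ (box d N) (hWm N) (Real.exp_pos _).le fun η => hN (.fixed η)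
  · filter_upwards [h3 hs] with N hN
    exact measureReal_le_of_forall_fixed hμ (box d N) (measurableSet_le measurable_const (measurable_sum_spinAt _))
      fun η => hN (.fixed η)
  · filter_upwards [h4 hs] with N hN
    exact measureReal_le_of_forall_fixed hμ (box d N) (measurableSet_le (measurable_sum_spinAt _) measurable_const)
      fun η => hN (.fixed η)

/-- **THE PLATEAU AT FIELD `h` UNDER EVERY GIBBS STATE** (`|a| ≤ m*(β)`; at `h ≠ 0` the state is unique and the bound exhibits the
affine Maxwell rate `ψ(h) − ψ(0) − βha`): eventually `exp(−|Λ_N|(ψ(h) − ψ(0) − βha + |βh|δ + ε)) ≤ μ{|M_N/|Λ_N| − a| < δ}`.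
[cite: Ellis2006, Thm. V.6.1; FollmerOrey1988, §3] -/
theorem gibbs_ld_lower_plateau_field (hd : 1 ≤ d) {β : ℝ} (hβ : 0 < β) {h : ℝ} {μ : Measure (SpinConfig (Site d))}
    (hμ : μ ∈ isingGibbsMeasures d β h) {a : ℝ} (ha : |a| ≤ spontaneousMagnetization d β) {δ : ℝ} (hδ : 0 < δ) {ε : ℝ}
    (hε : 0 < ε) :
    ∀ᶠ N : ℕ in atTop,
      Real.exp (-(#(box d N) * (pressure d β h - pressure d β 0 - β * h * a + |β * h| * δ + ε))) ≤
        μ.real {σ | |(∑ x ∈ box d N, spinAt x σ) / #(box d N) - a| < δ} := by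
  filter_upwards [eventually_forall_bc_ld_lower_plateau_field hd hβ h ha hδ hε] with N hN
  exact le_measureReal_of_forall_fixed hμ (box d N)
    (measurableSet_lt (((measurable_sum_spinAt _).div_const _).sub_const _).abs measurable_const) (Real.exp_pos _).le
    fun η => hN (.fixed η)

/-- **LD LOWER BOUND AT AN EXPOSED DENSITY UNDER EVERY GIBBS STATE**: if `ψ'(β,·)(h+s) = D` then for every `μ ∈ 𝒢(β,h)`, eventually
`exp(−|Λ_N|(sD − (ψ(h+s) − ψ(h)) + |βs|δ + ε)) ≤ μ{|M_N/|Λ_N| − D/β| < δ}`. [cite: Ellis2006, Thm. II.6.1 (c), Thm. V.6.1; Olla1988, Thm. 5.2] -/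
theorem gibbs_ld_lower_of_hasDerivAt (hd : 1 ≤ d) {β : ℝ} (hβ : 0 < β) {h s D : ℝ}
    (hD : HasDerivAt (fun t => pressure d β t) D (h + s)) {μ : Measure (SpinConfig (Site d))}
    (hμ : μ ∈ isingGibbsMeasures d β h) {δ : ℝ} (hδ : 0 < δ) {ε : ℝ} (hε : 0 < ε) :
    ∀ᶠ N : ℕ in atTop,
      Real.exp (-(#(box d N) * (s * D - (pressure d β (h + s) - pressure d β h) + |β * s| * δ + ε))) ≤
        μ.real {σ | |(∑ x ∈ box d N, spinAt x σ) / #(box d N) - D / β| < δ} := by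
  filter_upwards [eventually_forall_bc_ld_lower_of_hasDerivAt hd hβ hD hδ hε] with N hN
  exact le_measureReal_of_forall_fixed hμ (box d N)
    (measurableSet_lt (((measurable_sum_spinAt _).div_const _).sub_const _).abs measurable_const) (Real.exp_pos _).le
    fun η => hN (.fixed η)

end IsingLargeDeviations

end Summit.CriticalPhenomena.PercolationContinuityZ3.Theorems.FK
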